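import Literature.NumberTheory.EllipticCurves.TwoDescentOneRootRank
import Mathlib.LinearAlgebra.Charpoly.Basic
import Mathlib.FieldTheory.Minpoly.Field
import Mathlib.Tactic.ComputeDegree
import HarnessLib

/-!
# The generic `2`-descent over the cubic `2`-division field: discharging the standing hypotheses
# (Cassels, *Lectures on Elliptic Curves*, §15, the case "`F(T)` irreducible, `ℚ[Θ]` a cubic field")

Topic `NumberTheory/EllipticCurves`; sequel of `TwoDescentOneRoot{,Kernel,Rank}.lean`. Everything PROVED; no
named fact, no `sorry`.

The kernel and rank theorems of the generic `2`-descent (`exists_add_self_of_casselsMap_eq_zero`,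
`ker_casselsMap_eq`, `pow_mordellWeilRank_le_card_of_casselsMap_mem`) carry two standing hypotheses on the pair
`(L, θ)`: (H1) `1, θ, θ²` are linearly independent over `F`; (H2) every element of `L` is a root of a monic cubic over
`F`. Here they are discharged from the field-theoretic data of a CUBIC `2`-division field — the situation of Cassels
§15 when the `2`-division cubic is irreducible (`ℚ[Θ]` is a field of degree `3`):

* `indep_of_le_natDegree_minpoly` — (H1) from `3 ≤ deg minpoly_F(θ)` (a non-trivial `F`-relation of degree `≤ 2`
  would bound the minimal polynomial, Mathlib `minpoly.degree_le_of_ne_zero`);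
* `exists_monic_cubic_of_finrank_eq_three` — (H2) from `[L : F] = 3`, by Cayley–Hamilton for the multiplication map
  (Mathlib `LinearMap.aeval_self_charpoly`, `charpoly_natDegree`);
* **`pow_mordellWeilRank_le_card_of_finrank_eq_three`** — the rank bound `2 ^ rank E(F) ≤ #T` of
  `TwoDescentOneRootRank` for an elliptic curve `E/F` with `E(F)` finitely generated, a cubic extension `L/F`
  (`[L : F] = 3`) and a root `θ ∈ L` of the `2`-division cubic with `deg minpoly_F(θ) = 3` (i.e. `L = F(θ)`, `Ψ₂`
  irreducible), whenever the Cassels map `E(F) → Lˣ/Lˣ²` takes values in the finite set `T`;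
  `ker_casselsMap_eq_of_finrank_eq_three` — `ker μ = 2E(F)` in the same setting.

## References

* [Cassels1991LecturesEllipticCurves] J. W. S. Cassels, *Lectures on Elliptic Curves*, LMSST 24 (1991), §15
  (pp. 42–44): `μ`, Lemmas 1–2, the finite basis theorem; footnote 13 (the case of irreducible `F`).
-/

noncomputable section

open scoped Classical
open Polynomial

namespace WeierstrassCurve.Affine

variable {F : Type*} [Field F] {L : Type*} [Field L] [Algebra F L]

/-- **(H1) from the minimal polynomial**: if `deg minpoly_F(θ) ≥ 3` then `1, θ, θ²` are linearly independent over `F`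
(an `F`-relation `p + qθ + rθ² = 0` is a polynomial of degree `≤ 2` vanishing at `θ`, hence zero).
[cite: Cassels1991LecturesEllipticCurves, §15 (ℚ[Θ] ≅ ℚ[T]/F(T), F irreducible)] -/
theorem indep_of_le_natDegree_minpoly {θ : L} (h3 : 3 ≤ (minpoly F θ).natDegree) :
    ∀ p q r : F, algebraMap F L p + algebraMap F L q * θ + algebraMap F L r * θ ^ 2 = 0 →
      p = 0 ∧ q = 0 ∧ r = 0 := by
  intro p q r h
  set g : F[X] := C p + C q * X + C r * X ^ 2 with hg
  have hroot : aeval θ g = 0 := by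
    rw [hg, map_add, map_add, map_mul, map_mul, aeval_C, aeval_C, aeval_C, aeval_X, map_pow, aeval_X]
    exact h
  have hdeg : g.natDegree ≤ 2 := by
    rw [hg]
    compute_degree
  have hg0 : g = 0 := by
    by_contra hne
    have hle := minpoly.degree_le_of_ne_zero F θ hne hroot
    have : (minpoly F θ).natDegree ≤ g.natDegree := natDegree_le_natDegree hle
    omega
  have h0 : g.coeff 0 = p := by simp [hg]
  have h1 : g.coeff 1 = q := by simp [hg]
  have h2 : g.coeff 2 = r := by simp [hg]
  rw [hg0] at h0 h1 h2
  simp only [coeff_zero] at h0 h1 h2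
  exact ⟨h0.symm, h1.symm, h2.symm⟩

/-- **(H2) from the degree**: if `[L : F] = 3` every `v ∈ L` is a root of a monic cubic over `F` — the
characteristic polynomial of multiplication by `v` (Cayley–Hamilton).
[cite: Cassels1991LecturesEllipticCurves, §15 (Norm via the multiplication map)] -/
theorem exists_monic_cubic_of_finrank_eq_three [FiniteDimensional F L] (h3 : Module.finrank F L = 3) (v : L) :
    ∃ s₁ s₂ s₃ : F, v ^ 3 - algebraMap F L s₁ * v ^ 2 + algebraMap F L s₂ * v - algebraMap F L s₃ = 0 := by
  set f : Module.End F L := Algebra.lmul F L v with hf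
  set P : F[X] := f.charpoly with hP
  have hmonic : P.Monic := f.charpoly_monic
  have hdeg : P.natDegree = 3 := by rw [hP, LinearMap.charpoly_natDegree, h3]
  -- Cayley–Hamilton, transported along the algebra map `lmul : L → End_F L`
  have hCH : aeval f P = 0 := f.aeval_self_charpoly
  have hv : aeval v P = 0 := by
    have e : aeval f P = Algebra.lmul F L (aeval v P) := by
      rw [hf]; exact Polynomial.aeval_algHom_apply (Algebra.lmul F L) v P
    rw [e] at hCH
    have := congrArg (fun φ : Module.End F L ↦ φ 1) hCH
    simpa [Algebra.coe_lmul_eq_mul, LinearMap.mul_apply'] using this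
  rw [hmonic.as_sum, hdeg] at hv
  simp only [Finset.sum_range_succ, Finset.sum_range_zero, zero_add, pow_zero, mul_one, pow_one,
    map_add, map_pow, aeval_X, map_mul, aeval_C] at hv
  refine ⟨-P.coeff 2, P.coeff 1, -P.coeff 0, ?_⟩
  simp only [map_neg]
  linear_combination hv

end WeierstrassCurve.Affine

namespace WeierstrassCurve

open Affine Affine.Point

variable {F : Type*} [Field F] [CharZero F] (V : WeierstrassCurve F) [V.IsElliptic]
variable (L : Type*) [Field L] [CharZero L] [Algebra F L] [FiniteDimensional F L] {θ : L}
  [(V.baseChange L).IsElliptic]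

/-- **`ker μ = 2E(F)` over the cubic `2`-division field**: for `E/F` elliptic, `L/F` with `[L : F] = 3` and a root
`θ ∈ L` of the `2`-division cubic with `deg minpoly_F(θ) = 3` (so `L = F(θ)` and `Ψ₂` is irreducible over `F`), the
Cassels map `μ : E(F) →+ Lˣ/Lˣ²` has kernel exactly `2E(F)` (Cassels §15 Lemma 2).
[cite: Cassels1991LecturesEllipticCurves, §15 Lemma 2] -/
theorem ker_casselsMap_eq_of_finrank_eq_three (h3 : Module.finrank F L = 3)
    (hθ : (V.baseChange L).toAffine.IsTwoTorsionX θ) (hmin : (minpoly F θ).natDegree = 3) :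
    (casselsMap (V := V) L hθ).ker = (nsmulAddMonoidHom 2 : V.toAffine.Point →+ V.toAffine.Point).range :=
  ker_casselsMap_eq V L hθ (indep_of_le_natDegree_minpoly hmin.ge) (exists_monic_cubic_of_finrank_eq_three h3)

/-- **The generic `2`-descent rank bound over the cubic `2`-division field** (Cassels §15, weak finite basis
theorem): in the setting of `ker_casselsMap_eq_of_finrank_eq_three`, with `E(F)` finitely generated, if the
Cassels map takes values in a finite set `T ⊆ Lˣ/Lˣ²` then `2 ^ rank E(F) ≤ #T`.
[cite: Cassels1991LecturesEllipticCurves, §15 Theorem (finite basis) with Lemmas 1–2] -/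
theorem pow_mordellWeilRank_le_card_of_finrank_eq_three [Module.Finite ℤ V.toAffine.Point]
    (h3 : Module.finrank F L = 3) (hθ : (V.baseChange L).toAffine.IsTwoTorsionX θ)
    (hmin : (minpoly F θ).natDegree = 3) (T : Finset (Additive (SqUnits L)))
    (hT : ∀ P : V.toAffine.Point, casselsMap (V := V) L hθ P ∈ T) :
    2 ^ V.mordellWeilRank ≤ T.card :=
  pow_mordellWeilRank_le_card_of_casselsMap_mem V L hθ (indep_of_le_natDegree_minpoly hmin.ge)
    (exists_monic_cubic_of_finrank_eq_three h3) T hT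

end WeierstrassCurve

end
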